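import Summits.Ventures.Crystal3D.Bulk.HalfTanCertZRows1
import Summits.Ventures.Crystal3D.Bulk.HalfTanCertZRows2
import HarnessLib

/-!
# The Tammes-bridge certificate replayed by the KERNEL, blocks 6–7 (rows 101–252) and all rows

Venture `Crystal3D` (cell `pub-crystal3d`, phase 2; seat p3; certificate design and data by seat idea-2,
`phase2/idea2/TAMMES-BRIDGE.md` §F). `HalfTanCertZ.lean` states idea-2's box rule in exact natural-number arithmetic
(`CertZ.certRowsZ`); the Lean kernel EVALUATES it (`decide +kernel`, standard axioms — no `native_decide`), the `253` rows in
seven blocks of `≈ 10⁵` box evaluations (`673 651` in all, `≈ 25–45 s` of kernel time per block on the farm) spread over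
`HalfTanCertZRows1.lean`, `HalfTanCertZRows2.lean` and `HalfTanCertZAll.lean` (which unpacks the blocks into `certRowZ_true` /
`certPairZ_true`). Together with `HalfTanSoundZ*.lean` this replaces the compiled replay `CertW.certAll_true` (`native_decide`,
axiom `Lean.ofReduceBool`) of `HalfTanCert.lean` on the path to `HalfTanWitness 0.63 0.957`.
This file: blocks 6–7, then `certRowZ_true` (every row) and `certPairZ_true` (every piece pair `ka ≤ kb < 253`).
HONEST FRAMING: a computation checked by the kernel's definitional evaluation (GMP-backed `Nat` primitives); nothing geometric is
proved here; the bridge's one named hypothesis `musinTarasov2012_tammes_thirteen` is untouched.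
-/

namespace Summit.Ventures.Crystal3D.TammesBridge

namespace CertZ

/-- Rows `101 ≤ ka < 105` of the integer certificate (kernel evaluation, ≈ 10⁵ box evaluations). [folklore] -/
theorem certRowsZ_101_105 : certRowsZ 101 105 = true := by
  decide +kernel

/-- Rows `105 ≤ ka < 253` of the integer certificate (kernel evaluation, ≈ 10⁵ box evaluations). [folklore] -/
theorem certRowsZ_105_253 : certRowsZ 105 253 = true := by
  decide +kernel

/-- A certified block of rows certifies each of its rows. [folklore] -/
theorem certRowZ_of_rows {a b k : ℕ} (h : certRowsZ a b = true) (hak : a ≤ k) (hkb : k < b) : certRowZ k = true := by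
  unfold certRowsZ at h
  rw [List.all_eq_true] at h
  have := h (k - a) (List.mem_range.2 (by omega))
  rwa [Nat.add_sub_cancel' hak] at this

/-- **Every row is certified** (`0 ≤ ka < 253`). [folklore] -/
theorem certRowZ_true (ka : ℕ) (hka : ka < 253) : certRowZ ka = true := by
  rcases Nat.lt_or_ge ka 31 with h1 | h1
  · exact certRowZ_of_rows certRowsZ_0_31 (Nat.zero_le _) h1
  rcases Nat.lt_or_ge ka 45 with h2 | h2
  · exact certRowZ_of_rows certRowsZ_31_45 h1 h2
  rcases Nat.lt_or_ge ka 56 with h3 | h3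
  · exact certRowZ_of_rows certRowsZ_45_56 h2 h3
  rcases Nat.lt_or_ge ka 83 with h4 | h4
  · exact certRowZ_of_rows certRowsZ_56_83 h3 h4
  rcases Nat.lt_or_ge ka 101 with h5 | h5
  · exact certRowZ_of_rows certRowsZ_83_101 h4 h5
  rcases Nat.lt_or_ge ka 105 with h6 | h6
  · exact certRowZ_of_rows certRowsZ_101_105 h5 h6
  · exact certRowZ_of_rows certRowsZ_105_253 h6 hka

/-- **Every piece pair `ka ≤ kb < 253` is certified** by the integer checker (kernel evaluation; standard axioms). [folklore] -/
theorem certPairZ_true {ka kb : ℕ} (hk : ka ≤ kb) (hkb : kb < 253) : certPairZ ka kb = true := by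
  have h := certRowZ_true ka (by omega)
  unfold certRowZ at h
  rw [List.all_eq_true] at h
  have := h (kb - ka) (List.mem_range.2 (by omega))
  rwa [Nat.add_sub_cancel' hk] at this

end CertZ

end Summit.Ventures.Crystal3D.TammesBridge
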